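import Literature.AlgebraicGeometry.HodgeTheory.SymbolClasses
import Literature.Geometry.Kaehler.HolomorphicLineBundleChernConnection
import Literature.Geometry.Kaehler.TwoFormPowers
import Literature.Geometry.Kaehler.MatrixFormLocalCalculus
import HarnessLib

/-!
# Čech cup powers of a holomorphic line cocycle, I: the symbol forms `dlog g ∧ ⋯ ∧ dlog g` and their staircase identities

All proved: the Leibniz rules of the ordered Čech cup product with a
`0`- and a `1`-cochain of forms (`cech_cup_zero`, `cech_cup_one`; Bott–Tu (1982), §8 (8.4)); for a
holomorphic line cocycle `L` and `1`-forms `α_i` smooth on `U_i` with `dα_i = T` there and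
`dlog g_{ij} = α_i - α_j` on `U_i ∩ U_j`, the symbol forms `P_a(K) = dlog g_{K₀K₁} ∧ ⋯ ∧ dlog g_{K_{a-1}K_a}`
of the cup powers `L.symbolCochain` (`symbolForm_symbolCochain`) are smooth and closed at the points
of `U_K` (`smoothAt_dlogWedge`), `δ P_a = 0` there (`cechδ_dlogWedge_apply`), `δ(P_a ∪ α) = (-1)^{a+1} P_{a+1}`
there (`dlogWedge_telescope_apply`), and `d((P_a ∧ α) ∧ T^m) = (-1)^a (P_a ∧ T) ∧ T^m` there
(`mextDeriv_stair`); the instance of the Chern connection of a Hermitian metric with Chern form `θ`,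
`α_i = ∂ log h_i`, `T = -2πi θ` (`chern_dlog` is the gauge law, Kobayashi (1.16); `chern_mextDeriv`).

Provenance: Literature home (namespace `Literature.AlgebraicGeometry.HodgeTheory.SymbolCocycles`) of the Summits-side `Theorems/MilnorKExponentialSymbolLiftRPowerNormalisationForms` (route `MilnorKExponential` of the Hodge summit, crux `SymbolLiftR`; all its imports are `Literature/` and Mathlib); theorems only, no named fact, no definition; the route's packaged `stub_…` statement is kept under a `…_closed` name. Lane `lit-hodgefound` (Layer A1: Čech–de Rham calculus, Milnor symbols and symbol classes), seat p20.
-/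

noncomputable section
open scoped Manifold ContDiff _root_.Topology

namespace Literature.AlgebraicGeometry.HodgeTheory.SymbolCocycles
open Literature.AlgebraicGeometry Literature.AlgebraicGeometry.HodgeTheory
open Literature.Geometry.Kaehler Literature.NumberTheory.Transcendental

namespace PowerNormalisation

open Set Filter

/-! ### Part 1. Form-level algebra: Leibniz rules of the ordered Čech cup product -/

section FormAlgebra

variable {E : Type*} [NormedAddCommGroup E] [NormedSpace ℝ E]
  {H : Type*} [TopologicalSpace H] {I : ModelWithCorners ℝ E H}
  {M : Type*} [TopologicalSpace M] [ChartedSpace H M]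
  {A : Type*} [NormedCommRing A] [NormedAlgebra ℝ A] {ι : Type*}

/-- The face maps `σ_j`, `j ≤ a`, fix the last vertex: `σ_j(a) = a + 1`. [cite: BottTu1982Forms, §8 (8.4)] -/
theorem succAbove_castSucc_last {a : ℕ} (j : Fin (a + 1)) :
    (Fin.castSucc j).succAbove (Fin.last a) = Fin.last (a + 1) := by
  rw [Fin.succAbove_of_le_castSucc _ _ (Fin.castSucc_le_castSucc_iff.2 (Fin.le_last j)), Fin.succ_last]

/-- `(∑ cᵢ • αᵢ) ∧ β = ∑ cᵢ • (αᵢ ∧ β)`. [cite: BottTu1982Forms, §8 (8.4)] -/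
theorem sum_smul_wedge {k l : ℕ} {β' : Type*} (s : Finset β') (c : β' → ℝ) (α : β' → MForm I M A k)
    (β : MForm I M A l) : (∑ b ∈ s, c b • α b).wedge β = ∑ b ∈ s, c b • (α b).wedge β := by
  rw [MForm.sum_wedge]
  exact Finset.sum_congr rfl fun b _ ↦ MForm.wedge_smul_left _ _ _

/-- `α ∧ (-β) = -(α ∧ β)`. [cite: BottTu1982Forms, §8 (8.4)] -/
theorem wedge_neg_right {k l : ℕ} (α : MForm I M A k) (β : MForm I M A l) : α.wedge (-β) = -(α.wedge β) := by
  rw [← neg_one_smul ℝ β, MForm.wedge_smul_right, neg_one_smul]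

/-- **Leibniz rule for the ordered Čech cup product with a `0`-cochain**:
`δ(f ∪ g)(K) = (δf)(K) ∧ g(K_{a+1}) + (-1)^a f(K|_{≤ a}) ∧ (g(K_{a+1}) - g(K_a))`.
[cite: BottTu1982Forms, §8 (8.4)] -/
theorem cech_cup_zero {p l a : ℕ} (f : (Fin (a + 1) → ι) → MForm I M A p) (g : ι → MForm I M A l)
    (K : Fin (a + 2) → ι) :
    ∑ j : Fin (a + 2), (-1 : ℝ) ^ (j : ℕ) •
        (f (K ∘ Fin.succAbove j)).wedge (g (K (j.succAbove (Fin.last a)))) =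
      (∑ j : Fin (a + 2), (-1 : ℝ) ^ (j : ℕ) • f (K ∘ Fin.succAbove j)).wedge (g (K (Fin.last (a + 1)))) +
        (-1 : ℝ) ^ a • ((f (K ∘ Fin.castSucc)).wedge (g (K (Fin.last (a + 1)))) -
          (f (K ∘ Fin.castSucc)).wedge (g (K (Fin.castSucc (Fin.last a))))) := by
  conv_lhs => rw [Fin.sum_univ_castSucc]
  conv_rhs => rw [Fin.sum_univ_castSucc]
  simp only [succAbove_castSucc_last, Fin.succAbove_last, Fin.val_last, Fin.val_castSucc,
    sum_smul_wedge, MForm.wedge_add_left, MForm.wedge_smul_left, pow_succ, smul_sub]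
  module

/-- **Leibniz rule for the ordered Čech cup product with a `1`-cochain**:
`δ(f ∪ g)(K) = (δf ∪ g)(K) + (-1)^a f(K|_{≤ a}) ∧ (δg)(K_a, K_{a+1}, K_{a+2})`.
[cite: BottTu1982Forms, §8 (8.4)] -/
theorem cech_cup_one {p l a : ℕ} (f : (Fin (a + 1) → ι) → MForm I M A p) (g : ι → ι → MForm I M A l)
    (K : Fin (a + 3) → ι) :
    ∑ j : Fin (a + 3), (-1 : ℝ) ^ (j : ℕ) •
        (f ((K ∘ Fin.succAbove j) ∘ Fin.castSucc)).wedge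
          (g (K (j.succAbove (Fin.castSucc (Fin.last a)))) (K (j.succAbove (Fin.last (a + 1))))) =
      (∑ j : Fin (a + 2), (-1 : ℝ) ^ (j : ℕ) • f ((K ∘ Fin.castSucc) ∘ Fin.succAbove j)).wedge
          (g (K (Fin.castSucc (Fin.last (a + 1)))) (K (Fin.last (a + 2)))) +
        (-1 : ℝ) ^ a • (f ((K ∘ Fin.castSucc) ∘ Fin.castSucc)).wedge
          (g (K (Fin.castSucc (Fin.last (a + 1)))) (K (Fin.last (a + 2))) -
            g (K (Fin.castSucc (Fin.castSucc (Fin.last a)))) (K (Fin.last (a + 2))) +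
            g (K (Fin.castSucc (Fin.castSucc (Fin.last a)))) (K (Fin.castSucc (Fin.last (a + 1))))) := by
  -- faces `j ≤ a`
  have hC : ∀ j : Fin (a + 1),
      (K ∘ Fin.succAbove (Fin.castSucc (Fin.castSucc j))) ∘ Fin.castSucc =
        (K ∘ Fin.castSucc) ∘ Fin.succAbove (Fin.castSucc j) := by
    intro j
    funext i
    simp only [Function.comp_apply, Fin.castSucc_succAbove_castSucc]
  have hC1 : ∀ j : Fin (a + 1),
      (Fin.castSucc (Fin.castSucc j)).succAbove (Fin.castSucc (Fin.last a)) =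
        Fin.castSucc (Fin.last (a + 1)) := by
    intro j
    rw [Fin.castSucc_succAbove_castSucc, succAbove_castSucc_last]
  have hC2 : ∀ j : Fin (a + 1),
      (Fin.castSucc (Fin.castSucc j)).succAbove (Fin.last (a + 1)) = Fin.last (a + 2) := fun j ↦
    succAbove_castSucc_last (Fin.castSucc j)
  -- face `j = a + 1`
  have hB : (K ∘ Fin.succAbove (Fin.castSucc (Fin.last (a + 1)))) ∘ Fin.castSucc =
      (K ∘ Fin.castSucc) ∘ Fin.castSucc := by
    funext i
    simp only [Function.comp_apply, Fin.castSucc_succAbove_castSucc, Fin.succAbove_last]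
  have hB1 : (Fin.castSucc (Fin.last (a + 1))).succAbove (Fin.castSucc (Fin.last a)) =
      Fin.castSucc (Fin.castSucc (Fin.last a)) := by
    rw [Fin.castSucc_succAbove_castSucc, Fin.succAbove_last]
  have hB2 : (Fin.castSucc (Fin.last (a + 1))).succAbove (Fin.last (a + 1)) = Fin.last (a + 2) :=
    succAbove_castSucc_last (Fin.last (a + 1))
  -- (the face `j = a + 2` is `Fin.succAbove_last`)
  conv_lhs => rw [Fin.sum_univ_castSucc, Fin.sum_univ_castSucc]
  conv_rhs => rw [Fin.sum_univ_castSucc]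
  simp only [hC, hC1, hC2, hB, hB1, hB2, Fin.succAbove_last, Fin.val_last, Fin.val_castSucc,
    sum_smul_wedge, MForm.wedge_add_left, MForm.wedge_smul_left, MForm.wedge_add_right, MForm.wedge_sub,
    pow_succ, smul_add, smul_sub]
  module

/-! #### Pointwise vanishing and congruence helpers -/

/-- `(α ∧ β)(x) = 0` if `α(x) = 0`. [cite: BottTu1982Forms, §8 (8.4)] -/
theorem wedge_apply_eq_zero_left {k l : ℕ} {α : MForm I M A k} (β : MForm I M A l) {x : M}
    (h : α x = 0) : (α.wedge β) x = 0 := by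
  rw [MForm.wedge_apply, h]
  exact ContinuousAlternatingMap.zero_wedge _

/-- `(α ∧ β)(x) = 0` if `β(x) = 0`. [cite: BottTu1982Forms, §8 (8.4)] -/
theorem wedge_apply_eq_zero_right {k l : ℕ} (α : MForm I M A k) {β : MForm I M A l} {x : M}
    (h : β x = 0) : (α.wedge β) x = 0 := by
  rw [MForm.wedge_apply, h]
  exact ContinuousAlternatingMap.wedge_zero _

/-- `(α ∧ β)(x)` depends only on `β(x)`. [cite: BottTu1982Forms, §8 (8.4)] -/
theorem wedge_apply_congr_right {k l : ℕ} (α : MForm I M A k) {β β' : MForm I M A l} {x : M}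
    (h : β x = β' x) : (α.wedge β) x = (α.wedge β') x := by
  rw [MForm.wedge_apply, MForm.wedge_apply, h]

/-- `(α ∧ β)(x)` depends only on `α(x)`. [cite: BottTu1982Forms, §8 (8.4)] -/
theorem wedge_apply_congr_left {k l : ℕ} {α α' : MForm I M A k} (β : MForm I M A l) {x : M}
    (h : α x = α' x) : (α.wedge β) x = (α'.wedge β) x := by
  rw [MForm.wedge_apply, MForm.wedge_apply, h]

/-- `(c • α)(x) = 0` if `α(x) = 0`. [cite: BottTu1982Forms, §8 (8.4)] -/
theorem smul_apply_eq_zero {k : ℕ} (c : ℝ) {α : MForm I M A k} {x : M} (h : α x = 0) :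
    (c • α) x = 0 := by
  rw [Pi.smul_apply, h]
  exact smul_zero c

/-- `(α.castDeg e)(x) = 0` if `α(x) = 0`. [cite: BottTu1982Forms, §8 (8.4)] -/
theorem castDeg_apply_eq_zero {k k' : ℕ} (e : k = k') {α : MForm I M A k} {x : M} (h : α x = 0) :
    α.castDeg e x = 0 := by
  subst e
  exact h

end FormAlgebra

/-! ### Part 2. The symbol forms of the cup powers of a transition cocycle, pointwise on `U_K` -/

section SymbolForms

variable {E : Type*} [NormedAddCommGroup E] [NormedSpace ℂ E]
  {M : Type*} [TopologicalSpace M] [ChartedSpace E M] {ι : Type*}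

/-- The symbol forms of `L.symbolCochain q` are `dlog g_{J₀J₁} ∧ ⋯ ∧ dlog g_{J_qJ_{q+1}}`. [cite: BottTu1982Forms, §8 (8.4)] -/
theorem symbolForm_symbolCochain (L : HolomorphicLineBundle ι E M) (q : ℕ) (J : Fin (q + 2) → ι) :
    symbolForm E (q + 1) (L.symbolCochain q J) =
      dlogWedge E (q + 1) fun i : Fin (q + 1) ↦ L.coordChange (J (Fin.castSucc i)) (J i.succ) := by
  rw [HolomorphicLineBundle.symbolCochain_apply, symbolForm_single, one_smul]

/-- `P_{a+1}(K) = P_a(K|_{≤ a}) ∧ dlog g_{K_a K_{a+1}}`. [cite: BottTu1982Forms, §8 (8.4)] -/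
theorem dlogWedge_coordChange_succ (L : HolomorphicLineBundle ι E M) (a : ℕ) (K : Fin (a + 2) → ι) :
    dlogWedge E (a + 1) (fun i : Fin (a + 1) ↦ L.coordChange (K (Fin.castSucc i)) (K i.succ)) =
      (dlogWedge E a fun i : Fin a ↦
          L.coordChange ((K ∘ Fin.castSucc) (Fin.castSucc i)) ((K ∘ Fin.castSucc) i.succ)).wedge
        (dlog E (L.coordChange (K (Fin.castSucc (Fin.last a))) (K (Fin.last (a + 1))))) := by
  rw [dlogWedge_succ]
  rfl

variable {L : HolomorphicLineBundle ι E M} {α : ι → MForm 𝓘(ℝ, E) M ℂ 1} {T : MForm 𝓘(ℝ, E) M ℂ 2}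

/-- `dlog g_{ab} = α_a - α_b` near every point of `U_a ∩ U_b`, if it holds on `U_a ∩ U_b`. [cite: BottTu1982Forms, §8 (8.4)] -/
theorem dlog_eventuallyEq
    (hlink : ∀ a b, ∀ x ∈ L.baseSet a ∩ L.baseSet b, dlog E (L.coordChange a b) x = (α a - α b) x)
    {a b : ι} {x : M} (ha : x ∈ L.baseSet a) (hb : x ∈ L.baseSet b) :
    ∀ᶠ y in 𝓝 x, dlog E (L.coordChange a b) y = (α a - α b) y := by
  filter_upwards [((L.isOpen_baseSet a).inter (L.isOpen_baseSet b)).mem_nhds ⟨ha, hb⟩] with y hy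
  exact hlink a b y hy

/-- `dlog g_{ab}` is smooth at the points of `U_a ∩ U_b`. [cite: BottTu1982Forms, §8 (8.4)] -/
theorem smoothAt_dlog_coordChange (hαs : ∀ i, ∀ x ∈ L.baseSet i, (α i).SmoothAt x)
    (hlink : ∀ a b, ∀ x ∈ L.baseSet a ∩ L.baseSet b, dlog E (L.coordChange a b) x = (α a - α b) x)
    {a b : ι} {x : M} (ha : x ∈ L.baseSet a) (hb : x ∈ L.baseSet b) :
    (dlog E (L.coordChange a b)).SmoothAt x :=
  (MForm.smoothAt_congr_of_eventuallyEq (dlog_eventuallyEq hlink ha hb)).2 ((hαs a x ha).sub (hαs b x hb))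

/-- `d(dlog g_{ab}) = 0` at the points of `U_a ∩ U_b` (`dα_a = dα_b = T` there). [cite: BottTu1982Forms, §8 (8.4)] -/
theorem mextDeriv_dlog_coordChange (hαs : ∀ i, ∀ x ∈ L.baseSet i, (α i).SmoothAt x)
    (hdα : ∀ i, ∀ x ∈ L.baseSet i, mextDeriv (α i) x = T x)
    (hlink : ∀ a b, ∀ x ∈ L.baseSet a ∩ L.baseSet b, dlog E (L.coordChange a b) x = (α a - α b) x)
    {a b : ι} {x : M} (ha : x ∈ L.baseSet a) (hb : x ∈ L.baseSet b) :
    mextDeriv (dlog E (L.coordChange a b)) x = 0 := by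
  rw [mextDeriv_congr_of_eventuallyEq (dlog_eventuallyEq hlink ha hb),
    mextDeriv_sub_apply (hαs a x ha) (hαs b x hb), hdα a x ha, hdα b x hb, sub_self]

/-- **`P_a(K)` is smooth and closed at the points of `U_K`** (pointwise Leibniz rule,
`d dlog g = 0`). [cite: BottTu1982Forms, §8 (8.4)] -/
theorem smoothAt_dlogWedge (hαs : ∀ i, ∀ x ∈ L.baseSet i, (α i).SmoothAt x)
    (hdα : ∀ i, ∀ x ∈ L.baseSet i, mextDeriv (α i) x = T x)
    (hlink : ∀ a b, ∀ x ∈ L.baseSet a ∩ L.baseSet b, dlog E (L.coordChange a b) x = (α a - α b) x) :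
    ∀ (a : ℕ) (K : Fin (a + 1) → ι) {x : M}, x ∈ cechSet L.baseSet K →
      (dlogWedge E a fun i : Fin a ↦ L.coordChange (K (Fin.castSucc i)) (K i.succ)).SmoothAt x ∧
        mextDeriv (dlogWedge E a fun i : Fin a ↦ L.coordChange (K (Fin.castSucc i)) (K i.succ)) x = 0
  | 0, K, x, _ => by
    rw [dlogWedge_zero, mextDeriv_ofFun_const]
    exact ⟨MForm.smoothAt_ofFun_of_contMDiffAt contMDiffAt_const, rfl⟩
  | a + 1, K, x, hx => by
    obtain ⟨hs, hd⟩ := smoothAt_dlogWedge hαs hdα hlink a (K ∘ Fin.castSucc) (cechSet_subset_comp _ K _ hx)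
    have ha := cechSet_subset_apply _ K (Fin.castSucc (Fin.last a)) hx
    have hb := cechSet_subset_apply _ K (Fin.last (a + 1)) hx
    have hls := smoothAt_dlog_coordChange hαs hlink ha hb
    rw [dlogWedge_coordChange_succ]
    refine ⟨hs.wedge hls, ?_⟩
    rw [mextDeriv_wedge_apply_of_smoothAt hs hls, castDeg_apply_eq_zero _ (wedge_apply_eq_zero_left _ hd),
      smul_apply_eq_zero _ (wedge_apply_eq_zero_right _ (mextDeriv_dlog_coordChange hαs hdα hlink ha hb)),
      add_zero]

/-- **`δ P_a = 0` at the points of `U_K`**: the cup powers of the `dlog` cocycle are Čech cocycles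
(Leibniz `cech_cup_one`; `dlog g_{vw} - dlog g_{uw} + dlog g_{uv} = 0` on `U_u ∩ U_v ∩ U_w`).
[cite: BottTu1982Forms, §8 (8.4)] -/
theorem cechδ_dlogWedge_apply
    (hlink : ∀ a b, ∀ x ∈ L.baseSet a ∩ L.baseSet b, dlog E (L.coordChange a b) x = (α a - α b) x) :
    ∀ (a : ℕ) (K : Fin (a + 2) → ι) {x : M}, x ∈ cechSet L.baseSet K →
      (∑ j : Fin (a + 2), (-1 : ℝ) ^ (j : ℕ) • dlogWedge E a fun i : Fin a ↦
        L.coordChange ((K ∘ Fin.succAbove j) (Fin.castSucc i)) ((K ∘ Fin.succAbove j) i.succ)) x = 0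
  | 0, K, x, _ => by
    have h : (∑ j : Fin 2, (-1 : ℝ) ^ (j : ℕ) • dlogWedge E 0 fun i : Fin 0 ↦
        L.coordChange ((K ∘ Fin.succAbove j) (Fin.castSucc i)) ((K ∘ Fin.succAbove j) i.succ)) = 0 := by
      rw [Fin.sum_univ_two]
      simp only [dlogWedge_zero, Fin.val_zero, Fin.val_one, pow_zero, pow_one]
      module
    rw [h]
    rfl
  | a + 1, K, x, hx => by
    have h := cech_cup_one
      (fun K' : Fin (a + 1) → ι ↦ dlogWedge E a fun i : Fin a ↦ L.coordChange (K' (Fin.castSucc i)) (K' i.succ))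
      (fun u w ↦ dlog E (L.coordChange u w)) K
    beta_reduce at h
    have hsum := Finset.sum_congr rfl fun (j : Fin (a + 3)) (_ : j ∈ Finset.univ) ↦
      congrArg ((-1 : ℝ) ^ (j : ℕ) • ·) (dlogWedge_coordChange_succ L a (K ∘ Fin.succAbove j))
    refine (congrFun (hsum.trans h) x).trans ?_
    have h1 := cechSet_subset_apply _ K (Fin.castSucc (Fin.castSucc (Fin.last a))) hx
    have h2 := cechSet_subset_apply _ K (Fin.castSucc (Fin.last (a + 1))) hx
    have h3 := cechSet_subset_apply _ K (Fin.last (a + 2)) hx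
    rw [Pi.add_apply, wedge_apply_eq_zero_left _
      (cechδ_dlogWedge_apply hlink a (K ∘ Fin.castSucc) (cechSet_subset_comp _ K _ hx)), zero_add]
    refine smul_apply_eq_zero _ (wedge_apply_eq_zero_right _ ?_)
    rw [Pi.add_apply, Pi.sub_apply, hlink _ _ x ⟨h2, h3⟩, hlink _ _ x ⟨h1, h3⟩, hlink _ _ x ⟨h1, h2⟩,
      Pi.sub_apply, Pi.sub_apply, Pi.sub_apply]
    abel

/-- **Telescoping at the points of `U_K`**:
`Σ_j (-1)^j P_a(K ∘ σ_j) ∧ α_{(K∘σ_j)_a} = (-1)^{a+1} P_{a+1}(K)` (Leibniz `cech_cup_zero`,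
`cechδ_dlogWedge_apply`, `dlog g_{ij} = α_i - α_j`). [cite: BottTu1982Forms, §8 (8.4)] -/
theorem dlogWedge_telescope_apply
    (hlink : ∀ a b, ∀ x ∈ L.baseSet a ∩ L.baseSet b, dlog E (L.coordChange a b) x = (α a - α b) x)
    (a : ℕ) (K : Fin (a + 2) → ι) {x : M} (hx : x ∈ cechSet L.baseSet K) :
    (∑ j : Fin (a + 2), (-1 : ℝ) ^ (j : ℕ) •
      (dlogWedge E a fun i : Fin a ↦
          L.coordChange ((K ∘ Fin.succAbove j) (Fin.castSucc i)) ((K ∘ Fin.succAbove j) i.succ)).wedge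
        (α ((K ∘ Fin.succAbove j) (Fin.last a)))) x =
      ((-1 : ℝ) ^ (a + 1) •
        dlogWedge E (a + 1) fun i : Fin (a + 1) ↦ L.coordChange (K (Fin.castSucc i)) (K i.succ)) x := by
  have h := cech_cup_zero
    (fun K' : Fin (a + 1) → ι ↦ dlogWedge E a fun i : Fin a ↦ L.coordChange (K' (Fin.castSucc i)) (K' i.succ))
    α K
  beta_reduce at h
  refine (congrFun h x).trans ?_
  have ha := cechSet_subset_apply _ K (Fin.castSucc (Fin.last a)) hx
  have hb := cechSet_subset_apply _ K (Fin.last (a + 1)) hx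
  rw [Pi.add_apply, wedge_apply_eq_zero_left _ (cechδ_dlogWedge_apply hlink a K hx), zero_add,
    ← MForm.wedge_sub, Pi.smul_apply, Pi.smul_apply, dlogWedge_coordChange_succ,
    wedge_apply_congr_right _ (hlink _ _ x ⟨ha, hb⟩),
    ← neg_sub (α (K (Fin.castSucc (Fin.last a)))) (α (K (Fin.last (a + 1)))), wedge_neg_right,
    Pi.neg_apply, pow_succ]
  module

variable [WedgeFacts 𝓘(ℝ, E) M ℂ]

/-- The staircase cochains `Y_{a,m}(K) = (P_a(K) ∧ α_{K_a}) ∧ T^m` are smooth at the points of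
`U_K`. [cite: BottTu1982Forms, §8 (8.4)] -/
theorem smoothAt_stair (hαs : ∀ i, ∀ x ∈ L.baseSet i, (α i).SmoothAt x)
    (hdα : ∀ i, ∀ x ∈ L.baseSet i, mextDeriv (α i) x = T x)
    (hlink : ∀ a b, ∀ x ∈ L.baseSet a ∩ L.baseSet b, dlog E (L.coordChange a b) x = (α a - α b) x)
    (hT : T ∈ closedSmoothForms 𝓘(ℝ, E) M ℂ 2) (a m : ℕ) (K : Fin (a + 1) → ι) {x : M}
    (hx : x ∈ cechSet L.baseSet K) :
    (((dlogWedge E a fun i : Fin a ↦ L.coordChange (K (Fin.castSucc i)) (K i.succ)).wedge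
        (α (K (Fin.last a)))).wedge (MForm.twoFormPow 𝓘(ℝ, E) M T m)).SmoothAt x :=
  (((smoothAt_dlogWedge hαs hdα hlink a K hx).1).wedge (hαs _ x (cechSet_subset_apply _ K _ hx))).wedge
    ((isSmoothForm_iff_smoothAt _).1 (isSmoothForm_twoFormPow hT.1 m) x)

/-- **`d Y_{a,m}(K) = (-1)^a (P_a(K) ∧ T) ∧ T^m` at the points of `U_K`** (pointwise Leibniz:
`dP = 0`, `dα = T`, `dT^m = 0`). [cite: BottTu1982Forms, §8 Prop. 8.8] -/
theorem mextDeriv_stair (hαs : ∀ i, ∀ x ∈ L.baseSet i, (α i).SmoothAt x)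
    (hdα : ∀ i, ∀ x ∈ L.baseSet i, mextDeriv (α i) x = T x)
    (hlink : ∀ a b, ∀ x ∈ L.baseSet a ∩ L.baseSet b, dlog E (L.coordChange a b) x = (α a - α b) x)
    (hT : T ∈ closedSmoothForms 𝓘(ℝ, E) M ℂ 2) (a m : ℕ) (K : Fin (a + 1) → ι) {x : M}
    (hx : x ∈ cechSet L.baseSet K) :
    mextDeriv (((dlogWedge E a fun i : Fin a ↦ L.coordChange (K (Fin.castSucc i)) (K i.succ)).wedge
        (α (K (Fin.last a)))).wedge (MForm.twoFormPow 𝓘(ℝ, E) M T m)) x =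
      (((-1 : ℝ) ^ a • ((dlogWedge E a fun i : Fin a ↦ L.coordChange (K (Fin.castSucc i)) (K i.succ)).wedge
        T).wedge (MForm.twoFormPow 𝓘(ℝ, E) M T m)).castDeg (by ring : a + 2 + 2 * m = a + 1 + 2 * m + 1)) x := by
  obtain ⟨hPs, hPd⟩ := smoothAt_dlogWedge hαs hdα hlink a K hx
  have hxa := cechSet_subset_apply _ K (Fin.last a) hx
  have hTm := twoFormPow_mem_closedSmoothForms hT m
  have hTs : (MForm.twoFormPow 𝓘(ℝ, E) M T m).SmoothAt x := (isSmoothForm_iff_smoothAt _).1 hTm.1 x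
  -- `d(P ∧ α) = (-1)^a P ∧ T` at `x`
  have hdPα : mextDeriv ((dlogWedge E a fun i : Fin a ↦ L.coordChange (K (Fin.castSucc i)) (K i.succ)).wedge
      (α (K (Fin.last a)))) x = ((-1 : ℝ) ^ a •
        (dlogWedge E a fun i : Fin a ↦ L.coordChange (K (Fin.castSucc i)) (K i.succ)).wedge T) x := by
    rw [mextDeriv_wedge_apply_of_smoothAt hPs (hαs _ x hxa),
      castDeg_apply_eq_zero _ (wedge_apply_eq_zero_left _ hPd), zero_add, Pi.smul_apply, Pi.smul_apply,
      wedge_apply_congr_right _ (hdα _ x hxa)]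
  -- `(P ∧ α) ∧ dT^m = 0`
  have h2 : (((dlogWedge E a fun i : Fin a ↦ L.coordChange (K (Fin.castSucc i)) (K i.succ)).wedge
      (α (K (Fin.last a)))).wedge (mextDeriv (MForm.twoFormPow 𝓘(ℝ, E) M T m))) x = 0 :=
    wedge_apply_eq_zero_right _ (by rw [show mextDeriv (MForm.twoFormPow 𝓘(ℝ, E) M T m) = 0 from hTm.2]; rfl)
  rw [mextDeriv_wedge_apply_of_smoothAt (hPs.wedge (hαs _ x hxa)) hTs, smul_apply_eq_zero _ h2, add_zero,
    MForm.castDeg_apply_eq _ (wedge_apply_congr_left _ hdPα), MForm.wedge_smul_left]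

end SymbolForms

/-! ### Part 2'. The Chern connection of a Hermitian holomorphic line cocycle: `α_i = ∂ log h_i`,
`T = -2πi θ` (gauge law, Kobayashi (1.16); `dα_i = -(i/2) d((d log h_i) ∘ J)`, `θ = (1/4π) d((d log h_i) ∘ J)`) -/

section Chern

variable {E : Type*} [NormedAddCommGroup E] [NormedSpace ℂ E]
  {M : Type*} [TopologicalSpace M] [ChartedSpace E M] [IsManifold 𝓘(ℂ, E) ω M] [IsManifold 𝓘(ℝ, E) ∞ M]
  {ι : Type*} {L : HolomorphicLineBundle ι E M}

/-- `∂ log h_i` is smooth at the points of `U_i`. [cite: Kobayashi1987, Ch. I §4 (4.12)] -/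
theorem chern_smoothAt (h : L.HermitianMetric) (i : ι) (x : M) (hx : x ∈ L.baseSet i) :
    (dPrime E (h.logWeight i)).SmoothAt x :=
  smoothAt_dPrime (h.eventually_smoothAt_ofFun_logWeight hx)

/-- **The gauge law in symbol form**: `dlog g_{ab} = ∂ log h_a - ∂ log h_b` on `U_a ∩ U_b`.
[cite: Kobayashi1987, Ch. I §1 (1.16)] -/
theorem chern_dlog [FiniteDimensional ℂ E] (h : L.HermitianMetric) (a b : ι) (x : M)
    (hx : x ∈ L.baseSet a ∩ L.baseSet b) :
    dlog E (L.coordChange a b) x = (dPrime E (h.logWeight a) - dPrime E (h.logWeight b)) x := by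
  rw [Pi.sub_apply, dlog_apply, h.dPrime_logWeight_eq hx.2 hx.1, add_sub_cancel_left,
    inv_eq_of_mul_eq_one_right (L.coordChange_mul_symm a b hx.1 hx.2)]

/-- **`d ∂ log h_i = -2πi θ` on `U_i`** for a Chern form `θ` of `(L, h)`.
[cite: Kobayashi1987, Ch. I §4 (4.12)] [cite: VoisinHodgeI2002, §3.3.1] -/
theorem chern_mextDeriv (h : L.HermitianMetric) {θ : MForm 𝓘(ℝ, E) M ℂ 2} (hθ : h.IsChernForm θ)
    (i : ι) (x : M) (hx : x ∈ L.baseSet i) :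
    mextDeriv (dPrime E (h.logWeight i)) x = ((-(2 * (Real.pi : ℂ) * Complex.I)) • θ) x := by
  have hD : (fun y ↦ (Real.log (h.weight i y) : ℂ)) = h.logWeight i := rfl
  rw [mextDeriv_dPrime_apply (h.eventually_smoothAt_ofFun_logWeight hx), Pi.smul_apply,
    hθ i x hx, HolomorphicLineBundle.HermitianMetric.localChernForm, Pi.smul_apply, hD]
  have hπ : (Real.pi : ℂ) ≠ 0 := Complex.ofReal_ne_zero.2 Real.pi_ne_zero
  ext v
  simp only [ContinuousAlternatingMap.smul_apply, smul_eq_mul, Complex.real_smul]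
  push_cast
  field_simp
  ring

omit [IsManifold 𝓘(ℂ, E) ω M] [IsManifold 𝓘(ℝ, E) ∞ M] in
/-- `-2πi θ` is a smooth closed form when `θ` is. [cite: BottTu1982Forms, §8 (8.4)] -/
theorem chern_closed {θ : MForm 𝓘(ℝ, E) M ℂ 2} (hθ : θ ∈ cclosedSmoothForms E M 2) :
    (-(2 * (Real.pi : ℂ) * Complex.I)) • θ ∈ closedSmoothForms 𝓘(ℝ, E) M ℂ 2 :=
  (mem_closedSmoothForms_iff _).2
    ((mem_cclosedSmoothForms_iff _).1 (Submodule.smul_mem _ (-(2 * (Real.pi : ℂ) * Complex.I)) hθ))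

end Chern

/-- **Packaged (closed) form, part I — the telescoping identity of the
symbol forms of the cup powers** (`dlogWedge_telescope_apply` with all data explicit): for a
holomorphic line cocycle `L` and `1`-forms `α_i` with `dlog g_{ij} = α_i - α_j` on `U_i ∩ U_j`,
`Σ_j (-1)^j P_a(K ∘ σ_j) ∧ α_{(K∘σ_j)_a} = (-1)^{a+1} P_{a+1}(K)` at the points of `U_K`.
[cite: BottTu1982Forms, §8 (8.4)] -/
theorem powerNormalisation_forms_closed : ∀ {E : Type} [NormedAddCommGroup E] [NormedSpace ℂ E] {M : Type} [TopologicalSpace M] [ChartedSpace E M] {ι : Type} (L : HolomorphicLineBundle ι E M) (α : ι → MForm 𝓘(ℝ, E) M ℂ 1), (∀ a b, ∀ x ∈ L.baseSet a ∩ L.baseSet b, dlog E (L.coordChange a b) x = (α a - α b) x) → ∀ (a : ℕ) (K : Fin (a + 2) → ι) (x : M), x ∈ cechSet L.baseSet K → (∑ j : Fin (a + 2), (-1 : ℝ) ^ (j : ℕ) • (dlogWedge E a fun i : Fin a ↦ L.coordChange ((K ∘ Fin.succAbove j) (Fin.castSucc i)) ((K ∘ Fin.succAbove j) i.succ)).wedge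 (α ((K ∘ Fin.succAbove j) (Fin.last a)))) x = ((-1 : ℝ) ^ (a + 1) • dlogWedge E (a + 1) fun i : Fin (a + 1) ↦ L.coordChange (K (Fin.castSucc i)) (K i.succ)) x :=
  fun L _ hlink a K _ hx ↦ dlogWedge_telescope_apply (L := L) hlink a K hx

end PowerNormalisation

end Literature.AlgebraicGeometry.HodgeTheory.SymbolCocycles

end
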